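import Mathlib
import Summits.KontsevichZagierPeriods.Zeta5Search.DenomLaw.LawZL5
import Summits.KontsevichZagierPeriods.Zeta5Search.DenomLaw.ZeroPointVFloorPal
import Summits.KontsevichZagierPeriods.Zeta5Search.DenomLaw.ShiftedL5Kit
import Summits.KontsevichZagierPeriods.Zeta5Search.DenomLaw.ZeroCoverKit
import Summits.KontsevichZagierPeriods.Zeta5Search.ZeroPointWindows
import HarnessLib

/-!
# ζ(5) search — COVER KITS for THEOREM ZL5 (`SecondOrder.lawZeroPointA5`, `9 − 2M`) and for «ZVP» (`cas_ge_of_zeroPointV_pal`) — DENOM-LAW prover-d1 gen 21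

HONEST FRAMING: systematic search; no irrationality claim unless certified.  Cell `pub-zeta5`, track «DENOM-LAW», seat `denom-prover-d1`
gen 21 (`HOME/denom-law/prover-d1/ATTEMPT-21.md` §5 (3)).  `p`-adic valuation bookkeeping for the explicit rationals `Cas_j(b)`; nothing about ζ(5);
no model exponent moves; records in print UNMOVED.

THEOREM ZL5 (`DenomLaw/LawZL5.lean`) needs the hypotheses of the ZERO-POINT law and of THEOREM L5 in one frame `(M, T)`.  For general-`b` profile
theorems both come FROM A COVER with kits already in the tree, exactly as gen 20's `LawZACoverKit` did for ZA: the zero-point class structure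
`ZeroWindowClasses b p M D S` with `|D| + |S| ≤ 1` (gen 17/18's `DenomLaw.zeroClasses_of_cover`; `ZeroWindows.point_eq_of_classes` makes all live orbit
points coincide), the six L5 clauses by gen 3's `DenomLaw.checkL5` / `clausesL5_of_cover` for `b`, transported to `b + e_j` by typer gen 13's
`lawA4Classes_shift` / `shapeClause_shift`, and the witness «a multipole class of exponent `≤ −M + 2`» from ONE typed class (`IsType`).  This file only
assembles: `zeroPointA5_of_classes` (ZL5 from `ZeroWindowClasses` + the six clauses + a multipole witness), `multipole_low_of_isType` (the witness from
one typed class), `zeroPointA5_of_cover` (everything from one cover and two spelled-out checks; no new definition) and the window wrapper `cover_ZL5`;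
a `decide` sanity check of both list checks on the simplest member of the double-pole family, `b = (12; 0⁷)`, `p = 7` (frame `(12, [−6,−6])`).
§2 does the same for «ZVP» (`DenomLaw/ZeroPointVFloorPal.lean`): the new combinatorial lemma `isPalindromic_classConfig_of_typeList` (a centre-free class
with palindromic TYPE LIST has a palindromic CONFIGURATION `IsPalindromic (classConfig b p x)` — THEOREM LB♯'s row hypothesis, so far discharged only by
`decide` per instance), `rowsPal_of_cover` (LB♯'s row constant from a spelled-out list check) and `zeroPointVPal_of_classes` / `zeroPointVPal_of_cover`.
-/

open Finset

namespace Summit.KontsevichZagierPeriods.Zeta5Search.DenomLaw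

open Summit.KontsevichZagierPeriods.Zeta5Search.ClusterValuation
open Summit.KontsevichZagierPeriods.Zeta5Search.CasoratianValuation (InPolytope shift casoratian)
open Summit.KontsevichZagierPeriods.Zeta5Search.WedgeDictionary (dOf)
open Summit.KontsevichZagierPeriods.Zeta5Search.ClassTypeCover
open Summit.KontsevichZagierPeriods.Zeta5Search.SecondOrder (classTypeList isRaise isRaise2 lawZeroPointA5 lawA4Classes_shift shapeClause_shift
  cas_ge_of_zeroPointV_pal topLevel tList tTop tList_pal spec_of_typeList level_bounds' le_b0_of_lt)
open Summit.KontsevichZagierPeriods.Zeta5Search.ZeroWindows (ZeroWindowClasses point_eq_of_classes)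
open Summit.KontsevichZagierPeriods.Zeta5Search.ResidueLaw (sum_classExp_range pointW pointV liveClasses)
open Summit.KontsevichZagierPeriods.Zeta5Search.RecordWindowsA4 (LawA4Classes)
open Summit.KontsevichZagierPeriods.Zeta5Search.SecondResidueLaw (ShapeClause)

variable {p : ℕ}

/-! ## §1 THEOREM ZL5 from the class structure -/

/-- **THEOREM ZL5 from the class structure**: `ZeroWindowClasses b p M D S` with palindromic `D`, `|D| + |S| ≤ 1`, the degree condition
`p(M − 2) ≤ 2d + 1`, THEOREM L5's six clauses for `b` in the frame `(M, T)` (`M ≥ 10` even, `T` a palindrome; the clauses for `b + e_j` follow by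
transport) and one multipole class of exponent `≤ −M + 2` give `9 − 2M ≤ v_p(Cas_j(b))`. -/
theorem zeroPointA5_of_classes {b : ℕ → ℤ} {j : ℕ} (hb : InPolytope b) (hb' : InPolytope (shift b j)) (hj1 : 1 ≤ j) (hj7 : j ≤ 7)
    (hpr : p.Prime) (hp5 : 5 ≤ p) (hpb : (p : ℤ) ≤ b 0) (hwin : (b 0 + 2 : ℤ) < (p : ℤ) ^ 2)
    {M : ℕ} (hM : 10 ≤ M) (hMe : Even M) {D S : List (List ℤ)} (hD : ∀ T ∈ D, T.reverse = T) (hlen : D.length + S.length ≤ 1)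
    (hC : ZeroWindowClasses b p M D S) (hdeg : (p : ℤ) * ((M : ℤ) - 2) ≤ 2 * dOf b + 1)
    {T : List ℤ} (hT : T.reverse = T) (hL : LawA4Classes b p M T) (hSh : ShapeClause b p M T)
    (hlow : ∃ x, x < p ∧ 2 ≤ classPoleCount b p x ∧ classExp b p x ≤ -(M : ℤ) + 2)
    (hcas : casoratian b j ≠ 0) : (9 : ℤ) - 2 * M ≤ padicValRat p (casoratian b j) := by
  haveI : Fact p.Prime := ⟨hpr⟩
  have hdeg' : (p : ℤ) * ((M : ℤ) - 2) + ∑ x ∈ range p, classExp b p x ≤ -4 := by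
    rw [sum_classExp_range b hb hp5]; omega
  have G3 : ∀ x, x < p → 1 ≤ classPoleCount b p x → classExp b p x = -(M : ℤ) →
      ¬ CentreIn b p x ∧ (classTypeList b p x).reverse = classTypeList b p x :=
    fun x hx h1 hE => ⟨(hC.2.1 x hx h1 hE).1, hD _ (hC.2.1 x hx h1 hE).2⟩
  have hL' := lawA4Classes_shift b hb hb' hj1 hj7 hpb (by omega) hL
  have hSh' := shapeClause_shift b hb hb' hj1 hj7 hpb (by omega) hL hSh
  refine lawZeroPointA5 b p j M T hb hb' hj1 hj7 hpr hp5 hpb hwin hM hMe hC.1 G3 hdeg' ?_ hT hL hL' hSh hSh' hlow hcas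
  intro x hx y hy
  obtain ⟨hW, hV⟩ := point_eq_of_classes b hb hpb (by omega) hMe hD hC hlen hx hy
  exact ⟨Or.inl (by rw [hW, sub_self]), Or.inl (by rw [hV, sub_self])⟩

/-- **The multipole witness from one typed class**: a class of type `(T₀, c₀)` with `≥ 2` poles and `expL ≤ −M + 2` is the required multipole class. -/
theorem multipole_low_of_isType [Fact p.Prime] {b : ℕ → ℤ} {x : ℕ} {T₀ : List ℤ} {c₀ : Bool} (hx : IsType b p x T₀ c₀) {M : ℕ}
    (h2 : 2 ≤ polesL T₀) (hE : expL (decide (¬ (2 : ℤ) ∣ b 0)) T₀ c₀ ≤ -(M : ℤ) + 2) :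
    ∃ x, x < p ∧ 2 ≤ classPoleCount b p x ∧ classExp b p x ≤ -(M : ℤ) + 2 :=
  ⟨x, hx.lt, by rw [hx.classPoleCount_eq]; exact h2, by rw [hx.classExp_eq]; exact hE⟩

/-- **THEOREM ZL5 from a cover of `b`**: the zero-point check of `DenomLaw.zeroClasses_of_cover` (data `D`, `S` with `|D| + |S| ≤ 1`), gen 3's
six-clause check `DenomLaw.checkL5` in the frame `(M, T)`, one typed multipole class of exponent `≤ −M + 2`, and the degree condition give
`9 − 2M ≤ v_p(Cas_j(b))`. -/
theorem zeroPointA5_of_cover {b : ℕ → ℤ} {j : ℕ} (hb : InPolytope b) (hb' : InPolytope (shift b j)) (hj1 : 1 ≤ j) (hj7 : j ≤ 7)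
    (hpr : p.Prime) (hp5 : 5 ≤ p) (hpb : (p : ℤ) ≤ b 0) (hwin : (b 0 + 2 : ℤ) < (p : ℤ) ^ 2)
    {TY : List (List ℤ × Bool)} (hcov : Cover b p TY) {M : ℕ} (hM : 10 ≤ M) (hMe : Even M)
    {D S : List (List ℤ)} (hD : ∀ T ∈ D, T.reverse = T) (hlen : D.length + S.length ≤ 1)
    (hchkZ : (TY.all fun tc =>
      decide (polesL tc.1 = 0) ||
      ((decide (-(M : ℤ) ≤ expL (decide (¬ (2 : ℤ) ∣ b 0)) tc.1 tc.2) &&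
        (!decide (expL (decide (¬ (2 : ℤ) ∣ b 0)) tc.1 tc.2 = -(M : ℤ)) || (!tc.2 && decide (tc.1 ∈ D)))) &&
        (!decide (expL (decide (¬ (2 : ℤ) ∣ b 0)) tc.1 tc.2 = -(M : ℤ) + 1) ||
          (D.any (fun T => isRaise T tc.1 || (decide (¬ (2 : ℤ) ∣ b 0) && tc.2 && decide (tc.1 = T))) ||
            (!tc.2 && (decide (tc.1 ∈ S) || decide (tc.1.reverse ∈ S))))))) = true)
    (hdeg : (p : ℤ) * ((M : ℤ) - 2) ≤ 2 * dOf b + 1) {T : List ℤ} (hT : T.reverse = T)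
    (hchkL : checkL5 (decide (¬ (2 : ℤ) ∣ b 0)) TY M T = true)
    {x₀ : ℕ} {T₀ : List ℤ} {c₀ : Bool} (hx₀ : IsType b p x₀ T₀ c₀) (h2 : 2 ≤ polesL T₀)
    (hE : expL (decide (¬ (2 : ℤ) ∣ b 0)) T₀ c₀ ≤ -(M : ℤ) + 2)
    (hcas : casoratian b j ≠ 0) : (9 : ℤ) - 2 * M ≤ padicValRat p (casoratian b j) := by
  haveI : Fact p.Prime := ⟨hpr⟩
  obtain ⟨hL, hSh⟩ := clausesL5_of_cover hcov hchkL
  exact zeroPointA5_of_classes hb hb' hj1 hj7 hpr hp5 hpb hwin hM hMe hD hlen (zeroClasses_of_cover hb.1.1 hcov hchkZ) hdeg hT hL hSh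
    (multipole_low_of_isType hx₀ h2 hE) hcas

/-- **WINDOW BOUND by THEOREM ZL5 from a cover**: `c ≤ v_p(Cas_j(b))` whenever `c ≤ 9 − 2M`. -/
theorem cover_ZL5 {b : ℕ → ℤ} {j : ℕ} (hb : InPolytope b) (hb' : InPolytope (shift b j)) (hj1 : 1 ≤ j) (hj7 : j ≤ 7)
    (hpr : p.Prime) (hp5 : 5 ≤ p) (hpb : (p : ℤ) ≤ b 0) (hwin : (b 0 + 2 : ℤ) < (p : ℤ) ^ 2)
    {TY : List (List ℤ × Bool)} (hcov : Cover b p TY) {M : ℕ} (hM : 10 ≤ M) (hMe : Even M)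
    {D S : List (List ℤ)} (hD : ∀ T ∈ D, T.reverse = T) (hlen : D.length + S.length ≤ 1)
    (hchkZ : (TY.all fun tc =>
      decide (polesL tc.1 = 0) ||
      ((decide (-(M : ℤ) ≤ expL (decide (¬ (2 : ℤ) ∣ b 0)) tc.1 tc.2) &&
        (!decide (expL (decide (¬ (2 : ℤ) ∣ b 0)) tc.1 tc.2 = -(M : ℤ)) || (!tc.2 && decide (tc.1 ∈ D)))) &&
        (!decide (expL (decide (¬ (2 : ℤ) ∣ b 0)) tc.1 tc.2 = -(M : ℤ) + 1) ||
          (D.any (fun T => isRaise T tc.1 || (decide (¬ (2 : ℤ) ∣ b 0) && tc.2 && decide (tc.1 = T))) ||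
            (!tc.2 && (decide (tc.1 ∈ S) || decide (tc.1.reverse ∈ S))))))) = true)
    (hdeg : (p : ℤ) * ((M : ℤ) - 2) ≤ 2 * dOf b + 1) {T : List ℤ} (hT : T.reverse = T)
    (hchkL : checkL5 (decide (¬ (2 : ℤ) ∣ b 0)) TY M T = true)
    {x₀ : ℕ} {T₀ : List ℤ} {c₀ : Bool} (hx₀ : IsType b p x₀ T₀ c₀) (h2 : 2 ≤ polesL T₀)
    (hE : expL (decide (¬ (2 : ℤ) ∣ b 0)) T₀ c₀ ≤ -(M : ℤ) + 2)
    {c : ℤ} (hc : c ≤ 9 - 2 * (M : ℤ)) (hcas : casoratian b j ≠ 0) : c ≤ padicValRat p (casoratian b j) :=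
  le_trans hc (zeroPointA5_of_cover hb hb' hj1 hj7 hpr hp5 hpb hwin hcov hM hMe hD hlen hchkZ hdeg hT hchkL hx₀ h2 hE hcas)

/-- Sanity of the zero-point check on the simplest member of the double-pole family, `b = (12; 0⁷)`, `p = 7` (class types `[−6,−6]` ×6 at `−12`,
centre-free, and the centre class `[−5]`, tame; `b₀` even), frame `M = 12`, `D = [[−6,−6]]`, `S = []` (exact `v₇(Cas₇) = −15 = 9 − 2M` there; node −15,
casLB −21, L5 = ZA = −16). -/
example : (([([-6, -6], false), ([-5], true)] : List (List ℤ × Bool)).all fun tc =>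
      decide (polesL tc.1 = 0) ||
      ((decide (-((12 : ℕ) : ℤ) ≤ expL false tc.1 tc.2) &&
        (!decide (expL false tc.1 tc.2 = -((12 : ℕ) : ℤ)) || (!tc.2 && decide (tc.1 ∈ ([[-6, -6]] : List (List ℤ)))))) &&
        (!decide (expL false tc.1 tc.2 = -((12 : ℕ) : ℤ) + 1) ||
          (([[-6, -6]] : List (List ℤ)).any (fun T => isRaise T tc.1 || (false && tc.2 && decide (tc.1 = T))) ||
            (!tc.2 && (decide (tc.1 ∈ ([] : List (List ℤ))) || decide (tc.1.reverse ∈ ([] : List (List ℤ))))))))) = true := by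
  decide

/-- … and of the six-clause L5 check in the same frame with `T = [−6,−6]` (`polesL [−6,−6] = 2`, `expL = −12 ≤ −M + 2` is the multipole witness). -/
example : checkL5 false [([-6, -6], false), ([-5], true)] 12 [-6, -6] = true ∧ polesL [-6, -6] = 2 ∧ expL false [-6, -6] false = -12 := by
  decide

/-! ## §2 «ZVP» from the class structure -/

/-- **A centre-free class with PALINDROMIC type list has a palindromic configuration** (`IsPalindromic (classConfig b p x)`, the hypothesis of
THEOREM LB♯'s palindromic row): the reflection `q ↦ (2x + Lp) − q` of the level class `{x, x+p, …, x+Lp}` preserves the net exponents. -/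
theorem isPalindromic_classConfig_of_typeList [Fact p.Prime] (b : ℕ → ℤ) (hpn : (p : ℤ) ≤ b 0) {x : ℕ} (hx : x < p)
    (hc : ¬ CentreIn b p x) (hpal : (classTypeList b p x).reverse = classTypeList b p x) (hpole : 1 ≤ classPoleCount b p x) :
    IsPalindromic (classConfig b p x) := by
  have hxn := le_b0_of_lt b hpn hx
  obtain ⟨hL, hL'⟩ := level_bounds' (p := p) b hxn
  obtain ⟨htop, he⟩ := spec_of_typeList b hxn (T := classTypeList b p x) rfl
  set L := topLevel b p x with hLdef
  have hcls := LevelClass.classSet_level b hx hL hL'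
  have hcfg : classConfig b p x = ((classSet b p x).filter fun s => netExp b s ≠ 0).image
      fun s => (((2 * s : ℕ) : ℤ), netExp b s) := by
    unfold classConfig; rw [if_neg (fun h => hc h.2), union_empty]
  have hmem : ∀ pe, pe ∈ classConfig b p x ↔
      ∃ k ≤ L, netExp b (x + k * p) ≠ 0 ∧ pe = (((2 * (x + k * p) : ℕ) : ℤ), netExp b (x + k * p)) := by
    intro pe
    rw [hcfg, mem_image]
    constructor
    · rintro ⟨s, hs, rfl⟩
      rw [mem_filter, hcls, mem_image] at hs
      obtain ⟨⟨k, hk, rfl⟩, hne⟩ := hs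
      exact ⟨k, by have := mem_range.1 hk; omega, hne, rfl⟩
    · rintro ⟨k, hk, hne, rfl⟩
      refine ⟨x + k * p, ?_, rfl⟩
      rw [mem_filter, hcls, mem_image]
      exact ⟨⟨k, mem_range.2 (by omega), rfl⟩, hne⟩
  have hpalk : ∀ k ≤ L, netExp b (x + (L - k) * p) = netExp b (x + k * p) := by
    intro k hk
    rw [he k hk, he (L - k) (by omega), ← htop]
    exact tList_pal hpal k (by omega)
  set m : ℤ := (((2 * x + L * p : ℕ) : ℤ)) * 2 with hm
  have hmirror : ∀ pe ∈ classConfig b p x, (m - pe.1, pe.2) ∈ classConfig b p x := by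
    intro pe hpe
    obtain ⟨k, hk, hne, rfl⟩ := (hmem pe).1 hpe
    refine (hmem _).2 ⟨L - k, by omega, by rw [hpalk k hk]; exact hne, ?_⟩
    simp only [Prod.mk.injEq]
    refine ⟨?_, (hpalk k hk).symm⟩
    push_cast [hm]
    have h2 : ((L - k : ℕ) : ℤ) = (L : ℤ) - k := by push_cast [Nat.cast_sub hk]; ring
    rw [h2]; ring
  obtain ⟨q, hq⟩ : ∃ q, q ∈ (classSet b p x).filter fun s => netExp b s < 0 := by
    by_contra h
    push Not at h
    have : ((classSet b p x).filter fun s => netExp b s < 0) = ∅ := eq_empty_of_forall_notMem h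
    unfold classPoleCount at hpole; rw [this, card_empty] at hpole; omega
  have hq' : (((2 * q : ℕ) : ℤ), netExp b q) ∈ classConfig b p x := by
    rw [hcfg, mem_image]
    obtain ⟨hqc, hqn⟩ := mem_filter.1 hq
    exact ⟨q, mem_filter.2 ⟨hqc, by omega⟩, rfl⟩
  refine ⟨m, ?_, hmirror⟩
  rw [mem_image]
  refine ⟨((((2 * q : ℕ) : ℤ), netExp b q), (m - ((2 * q : ℕ) : ℤ), netExp b q)), mem_product.2 ⟨hq', hmirror _ hq'⟩, ?_⟩
  simp only; ring

/-- **THEOREM LB♯'s row constant from a list check on a cover**: on every multipole type of the cover, `r ≤ 3 + E`, or the type is centre-free with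
palindromic list, `E ≤ −3`, `E` even and `r ≤ 4 + E` (spelled out as `List.all`; no new definition) — gives the multipole-row hypothesis of
`cas_val_ge_of_coeffV_pal` / `cas_ge_of_zeroPointV_pal`. -/
theorem rowsPal_of_cover [Fact p.Prime] {b : ℕ → ℤ} (hpb : (p : ℤ) ≤ b 0) {TY : List (List ℤ × Bool)} (hcov : Cover b p TY) {r : ℤ}
    (hchk : (TY.all fun tc => decide (polesL tc.1 < 2) ||
      (decide (r ≤ 3 + expL (decide (¬ (2 : ℤ) ∣ b 0)) tc.1 tc.2) ||
        (!tc.2 && decide (tc.1.reverse = tc.1) && decide (expL (decide (¬ (2 : ℤ) ∣ b 0)) tc.1 tc.2 ≤ -3) &&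
          decide (Even (expL (decide (¬ (2 : ℤ) ∣ b 0)) tc.1 tc.2)) && decide (r ≤ 4 + expL (decide (¬ (2 : ℤ) ∣ b 0)) tc.1 tc.2)))) = true) :
    ∀ x, x < p → 2 ≤ classPoleCount b p x →
      r ≤ 3 + classExp b p x ∨
        (classExp b p x ≤ -3 ∧ IsPalindromic (classConfig b p x) ∧ Odd (3 + classExp b p x) ∧ r ≤ 4 + classExp b p x) := by
  rw [List.all_eq_true] at hchk
  intro x hx h2
  obtain ⟨tc, htc, ht⟩ := hcov x hx
  have hc := hchk tc htc
  simp only [Bool.and_eq_true, Bool.or_eq_true, Bool.not_eq_true', decide_eq_true_eq] at hc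
  have h2' : 2 ≤ polesL tc.1 := by rw [← ht.classPoleCount_eq]; exact h2
  rcases hc with h | h | ⟨⟨⟨⟨hc0, hpal⟩, hE3⟩, hev⟩, hr⟩
  · omega
  · left; rw [ht.classExp_eq]; exact h
  · right
    have hnc : ¬ CentreIn b p x := fun hcen => by rw [ht.cen_iff.1 hcen] at hc0; exact Bool.noConfusion hc0
    have hpal' : (classTypeList b p x).reverse = classTypeList b p x := by rw [ht.classTypeList_eq]; exact hpal
    refine ⟨by rw [ht.classExp_eq]; exact hE3, isPalindromic_classConfig_of_typeList b hpb hx hnc hpal' (by omega), ?_,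
      by rw [ht.classExp_eq]; exact hr⟩
    rw [ht.classExp_eq]; obtain ⟨k, hk⟩ := hev; exact ⟨k + 1, by omega⟩

/-- **«ZVP» from the class structure**: `ZeroWindowClasses b p M D S` with palindromic `D`, `|D| + |S| ≤ 1`, the degree condition `p(M − 2) ≤ 2d + 1`
and a row constant `r` as in `cas_ge_of_zeroPointV_pal` give `(2 − M) + r ≤ v_p(Cas_j(b))`. -/
theorem zeroPointVPal_of_classes {b : ℕ → ℤ} {j : ℕ} (hb : InPolytope b) (hb' : InPolytope (shift b j)) (hj1 : 1 ≤ j) (hj7 : j ≤ 7)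
    (hpr : p.Prime) (hp5 : 5 ≤ p) (hpb : (p : ℤ) ≤ b 0) (hwin : (b 0 + 2 : ℤ) < (p : ℤ) ^ 2)
    {M : ℕ} (hM : 6 ≤ M) (hMe : Even M) {D S : List (List ℤ)} (hD : ∀ T ∈ D, T.reverse = T) (hlen : D.length + S.length ≤ 1)
    (hC : ZeroWindowClasses b p M D S) (hdeg : (p : ℤ) * ((M : ℤ) - 2) ≤ 2 * dOf b + 1)
    (r : ℤ) (hr1 : r ≤ 1)
    (hrm : ∀ x, x < p → 2 ≤ classPoleCount b p x →
      r ≤ 3 + classExp b p x ∨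
        (classExp b p x ≤ -3 ∧ IsPalindromic (classConfig b p x) ∧ Odd (3 + classExp b p x) ∧ r ≤ 4 + classExp b p x))
    (hr0 : dOf b < (p : ℤ) → r ≤ 0) (hcas : casoratian b j ≠ 0) :
    (2 - (M : ℤ)) + r ≤ padicValRat p (casoratian b j) := by
  haveI : Fact p.Prime := ⟨hpr⟩
  have hdeg' : (p : ℤ) * ((M : ℤ) - 2) + ∑ x ∈ range p, classExp b p x ≤ -4 := by
    rw [sum_classExp_range b hb hp5]; omega
  have G3 : ∀ x, x < p → 1 ≤ classPoleCount b p x → classExp b p x = -(M : ℤ) →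
      ¬ CentreIn b p x ∧ (classTypeList b p x).reverse = classTypeList b p x :=
    fun x hx h1 hE => ⟨(hC.2.1 x hx h1 hE).1, hD _ (hC.2.1 x hx h1 hE).2⟩
  refine cas_ge_of_zeroPointV_pal b p j M hb hb' hj1 hj7 hpr hp5 hpb hwin hM hMe hC.1 G3 hdeg' ?_ r hr1 hrm hr0 hcas
  intro x hx y hy
  obtain ⟨hW, hV⟩ := point_eq_of_classes b hb hpb hM hMe hD hC hlen hx hy
  exact ⟨Or.inl (by rw [hW, sub_self]), Or.inl (by rw [hV, sub_self])⟩

/-- **«ZVP» from a cover of `b`**: the zero-point check (data `D`, `S`, `|D| + |S| ≤ 1`), the degree condition and the palindromic-row check at `r`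
give `(2 − M) + r ≤ v_p(Cas_j(b))` (`r ≤ 1`; `r ≤ 0` unless `p ≤ d`). -/
theorem zeroPointVPal_of_cover {b : ℕ → ℤ} {j : ℕ} (hb : InPolytope b) (hb' : InPolytope (shift b j)) (hj1 : 1 ≤ j) (hj7 : j ≤ 7)
    (hpr : p.Prime) (hp5 : 5 ≤ p) (hpb : (p : ℤ) ≤ b 0) (hwin : (b 0 + 2 : ℤ) < (p : ℤ) ^ 2)
    {TY : List (List ℤ × Bool)} (hcov : Cover b p TY) {M : ℕ} (hM : 6 ≤ M) (hMe : Even M)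
    {D S : List (List ℤ)} (hD : ∀ T ∈ D, T.reverse = T) (hlen : D.length + S.length ≤ 1)
    (hchkZ : (TY.all fun tc =>
      decide (polesL tc.1 = 0) ||
      ((decide (-(M : ℤ) ≤ expL (decide (¬ (2 : ℤ) ∣ b 0)) tc.1 tc.2) &&
        (!decide (expL (decide (¬ (2 : ℤ) ∣ b 0)) tc.1 tc.2 = -(M : ℤ)) || (!tc.2 && decide (tc.1 ∈ D)))) &&
        (!decide (expL (decide (¬ (2 : ℤ) ∣ b 0)) tc.1 tc.2 = -(M : ℤ) + 1) ||
          (D.any (fun T => isRaise T tc.1 || (decide (¬ (2 : ℤ) ∣ b 0) && tc.2 && decide (tc.1 = T))) ||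
            (!tc.2 && (decide (tc.1 ∈ S) || decide (tc.1.reverse ∈ S))))))) = true)
    (hdeg : (p : ℤ) * ((M : ℤ) - 2) ≤ 2 * dOf b + 1) (r : ℤ) (hr1 : r ≤ 1)
    (hchkR : (TY.all fun tc => decide (polesL tc.1 < 2) ||
      (decide (r ≤ 3 + expL (decide (¬ (2 : ℤ) ∣ b 0)) tc.1 tc.2) ||
        (!tc.2 && decide (tc.1.reverse = tc.1) && decide (expL (decide (¬ (2 : ℤ) ∣ b 0)) tc.1 tc.2 ≤ -3) &&
          decide (Even (expL (decide (¬ (2 : ℤ) ∣ b 0)) tc.1 tc.2)) && decide (r ≤ 4 + expL (decide (¬ (2 : ℤ) ∣ b 0)) tc.1 tc.2)))) = true)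
    (hr0 : dOf b < (p : ℤ) → r ≤ 0) (hcas : casoratian b j ≠ 0) :
    (2 - (M : ℤ)) + r ≤ padicValRat p (casoratian b j) := by
  haveI : Fact p.Prime := ⟨hpr⟩
  exact zeroPointVPal_of_classes hb hb' hj1 hj7 hpr hp5 hpb hwin hM hMe hD hlen (zeroClasses_of_cover hb.1.1 hcov hchkZ) hdeg r hr1
    (rowsPal_of_cover hpb hcov hchkR) hr0 hcas

/-- Sanity of the palindromic-row check at `r = 0` on the head ZVP configuration (types of `b = (38; 17,17,16,13,12,12,5)`, `p = 11`: `[0,−6,0]` ×4 at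
`−6`, the centre class `[0,−5,0]` at `−5`, the deep palindromic pair `[1,−3,−3,1]` at `−4` with row `4 + E = 0`, and `[1,0,−4,0]`, `[0,−4,0,1]`,
`[1,−2,−3,1]`, `[1,−3,−2,1]` at `−3` with rows `3 + E = 0`; `b₀` even; exact `v₁₁(Cas₇) = −4 = (2 − 6) + 0`). -/
example : (([([0, -6, 0], false), ([0, -5, 0], true), ([1, -3, -3, 1], false), ([1, 0, -4, 0], false), ([0, -4, 0, 1], false),
      ([1, -2, -3, 1], false), ([1, -3, -2, 1], false)] : List (List ℤ × Bool)).all fun tc => decide (polesL tc.1 < 2) ||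
      (decide ((0 : ℤ) ≤ 3 + expL false tc.1 tc.2) ||
        (!tc.2 && decide (tc.1.reverse = tc.1) && decide (expL false tc.1 tc.2 ≤ -3) &&
          decide (Even (expL false tc.1 tc.2)) && decide ((0 : ℤ) ≤ 4 + expL false tc.1 tc.2)))) = true := by
  decide

end Summit.KontsevichZagierPeriods.Zeta5Search.DenomLaw
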